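import Summits.Ventures.HodgeRepro2.T5SU11KernelCompositionContinuous
import Summits.Ventures.HodgeRepro2.T5SU11KernelCompositionLipschitzUniform

/-!
# The composed kernels are jointly continuous in `(λ, t, s)` on `(1, ∞) × (0, ∞)²`

Row 605 bounds `|K_λ^{∘(n+1)}(t, s) − K_{λ₂}^{∘(n+1)}(t, s)|` by `|λ − λ₂|` times a constant uniform in `(t, s)` away from the corner
and in `λ, λ₂ ≥ λ₁ > 1`; row 613 gives the continuity of `(t, s) ↦ K_{λ₂}^{∘(n+1)}(t, s)` on `(0, ∞)²`. Splitting
`K_λ^{∘(n+1)}(t, s) − K_{λ₂}^{∘(n+1)}(t₀, s₀)` through `K_{λ₂}^{∘(n+1)}(t, s)` and localising the corner exclusion at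
`a = min(t₀, s₀)/2`:

* `abs_kernel_comp_sub_le_of_mem` — the explicit Lipschitz bound in `λ` near `(λ₂, t₀, s₀)`;
* `continuousOn_kernel_comp_prod3` — **`(λ, t, s) ↦ K_λ^{∘(n+1)}(t, s)` is continuous on `(1, ∞) × (0, ∞)²`** for every `n`;
* `continuousOn_kernel_prod3` — the case `n = 0`: **the kernel `(λ, t, s) ↦ K_λ(t, s)` is continuous on `(1, ∞) × (0, ∞)²`**.

Nothing is claimed about (N).

Blind lane: Mathlib + the HodgeRepro2 prefix only; no sorry; axioms ⊆ {propext, Classical.choice,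
Quot.sound}.
-/

namespace Summit.Ventures.HodgeRepro2.T5SU11KernelCompositionContinuousLam

open Filter Topology MeasureTheory
open Set (Ioi Ioc)
open T5SU11Cartan T5SU11SphericalFunction T5SU11SphericalBounds T5SU11SphericalDecay T5SU11RadialGreenKernel
  T5SU11RadialGreenImproper T5SU11KernelUniformBounds T5SU11KernelCompositionLipschitzUniform
  T5SU11KernelCompositionContinuous

section measure

variable [MeasurableSpace Circle] [BorelSpace Circle]

/-- **The Lipschitz bound in `λ` with a constant uniform in `(t, s)` on `{max(t, s) ≥ a}` and in `λ, λ₂ ∈ [λ₁, λ₂ + 1]`**: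
`|K_λ^{∘(n+1)}(t, s) − K_{λ₂}^{∘(n+1)}(t, s)| ≤ |λ − λ₂| · 2 λ₂ (n + 1) C/((λ₁ − 1)²)^{n+1}`. -/
theorem abs_kernel_comp_sub_le_of_mem {lam₁ lam₂ : ℝ} (hlam₁ : 1 < lam₁) (hlam₁₂ : lam₁ ≤ lam₂) {a : ℝ} (n : ℕ)
    {C : ℝ} (hC : 0 < C)
    (hC' : ∀ m : ℕ, ∀ t s, 0 < t → 0 < s → a ≤ max t s →
      |((greenSolI (fun t => sph lam₁ (hyp t)) (sphDecay lam₁))^[m] (fun r => sphGreenKernel lam₁ r s)) t|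
        ≤ C * sph 1 (hyp s) * sph 1 (hyp t) / ((lam₁ - 1) ^ 2) ^ m)
    {lam : ℝ} (hl₁ : lam₁ ≤ lam) (hl₂ : lam ≤ lam₂ + 1) {t s : ℝ} (ht : 0 < t) (hs : 0 < s) (hm : a ≤ max t s) :
    |((greenSolI (fun t => sph lam (hyp t)) (sphDecay lam))^[n] (fun r => sphGreenKernel lam r s)) t
        - ((greenSolI (fun t => sph lam₂ (hyp t)) (sphDecay lam₂))^[n] (fun r => sphGreenKernel lam₂ r s)) t|
      ≤ |lam - lam₂| * (2 * lam₂ * (n + 1) * (C / ((lam₁ - 1) ^ 2) ^ (n + 1))) := by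
  have hlam : 1 < lam := lt_of_lt_of_le hlam₁ hl₁
  have hlam₂ : 1 < lam₂ := lt_of_lt_of_le hlam₁ hlam₁₂
  have hr : 0 < (((lam₁ - 1) ^ 2) ^ (n + 1)) := by
    have : 0 < lam₁ - 1 := by linarith
    positivity
  refine (abs_kernel_comp_sub_le hs hlam hlam₂ n ht).trans ?_
  apply mul_le_mul_of_nonneg_left _ (abs_nonneg _)
  have hmin : lam₁ ≤ min lam lam₂ := le_min hl₁ hlam₁₂
  have hΞt : sph 1 (hyp t) ≤ 1 := sph_hyp_le_one zero_le_one one_le_two t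
  have hΞs : sph 1 (hyp s) ≤ 1 := sph_hyp_le_one zero_le_one one_le_two s
  have hΞt0 : 0 < sph 1 (hyp t) := sph_hyp_pos 1 t
  have hmax : 2 * (max lam lam₂ - 1) ≤ 2 * lam₂ := by
    have : max lam lam₂ ≤ lam₂ + 1 := max_le hl₂ (by linarith)
    linarith
  have hK : |((greenSolI (fun t => sph (min lam lam₂) (hyp t)) (sphDecay (min lam lam₂)))^[n + 1]
        (fun r => sphGreenKernel (min lam lam₂) r s)) t| ≤ C / ((lam₁ - 1) ^ 2) ^ (n + 1) := by
    calc |((greenSolI (fun t => sph (min lam lam₂) (hyp t)) (sphDecay (min lam lam₂)))^[n + 1]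
            (fun r => sphGreenKernel (min lam lam₂) r s)) t|
        ≤ |((greenSolI (fun t => sph lam₁ (hyp t)) (sphDecay lam₁))^[n + 1] (fun r => sphGreenKernel lam₁ r s)) t| :=
          abs_kernel_comp_antitone hs hlam₁ hmin (n + 1) ht
      _ ≤ C * sph 1 (hyp s) * sph 1 (hyp t) / ((lam₁ - 1) ^ 2) ^ (n + 1) := hC' (n + 1) t s ht hs hm
      _ ≤ C * 1 * 1 / ((lam₁ - 1) ^ 2) ^ (n + 1) := by
          apply div_le_div_of_nonneg_right _ hr.le
          exact mul_le_mul (mul_le_mul_of_nonneg_left hΞs hC.le) hΞt hΞt0.le (by positivity)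
      _ = C / ((lam₁ - 1) ^ 2) ^ (n + 1) := by ring
  calc 2 * (max lam lam₂ - 1) * (n + 1)
        * |((greenSolI (fun t => sph (min lam lam₂) (hyp t)) (sphDecay (min lam lam₂)))^[n + 1]
          (fun r => sphGreenKernel (min lam lam₂) r s)) t|
      ≤ 2 * lam₂ * (n + 1) * (C / ((lam₁ - 1) ^ 2) ^ (n + 1)) := by
        apply mul_le_mul (mul_le_mul_of_nonneg_right hmax (by positivity)) hK (abs_nonneg _) (by positivity)

/-- **THE COMPOSED KERNELS ARE JOINTLY CONTINUOUS IN `(λ, t, s)`**: `(λ, t, s) ↦ K_λ^{∘(n+1)}(t, s)` is continuous on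
`(1, ∞) × (0, ∞)²` for every `n`. -/
theorem continuousOn_kernel_comp_prod3 (n : ℕ) :
    ContinuousOn (fun p : ℝ × ℝ × ℝ => ((greenSolI (fun t => sph p.1 (hyp t)) (sphDecay p.1))^[n]
      (fun r => sphGreenKernel p.1 r p.2.2)) p.2.1) (Ioi 1 ×ˢ Ioi 0 ×ˢ Ioi 0) := by
  rintro ⟨lam₂, t₀, s₀⟩ ⟨hlam₂, ht₀, hs₀⟩
  have hlam₂' : (1 : ℝ) < lam₂ := hlam₂
  have ht₀' : (0 : ℝ) < t₀ := ht₀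
  have hs₀' : (0 : ℝ) < s₀ := hs₀
  rw [Metric.continuousWithinAt_iff]
  intro ε hε
  -- the corner exclusion `a`, the lower spectral bound `λ₁`, the uniform constant and the Lipschitz constant `M`
  set a : ℝ := min t₀ s₀ / 2 with ha_def
  have ha : 0 < a := by
    rw [ha_def]
    exact half_pos (lt_min ht₀' hs₀')
  set lam₁ : ℝ := (1 + lam₂) / 2 with hlam₁_def
  have hlam₁ : 1 < lam₁ := by rw [hlam₁_def]; linarith
  have hlam₁₂ : lam₁ < lam₂ := by rw [hlam₁_def]; linarith
  obtain ⟨C, hC, hC'⟩ := exists_kernel_comp_le_uniform_of_le_max hlam₁ ha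
  set M : ℝ := 2 * lam₂ * (n + 1) * (C / ((lam₁ - 1) ^ 2) ^ (n + 1)) with hM_def
  have hM : 0 < M := by
    have : 0 < lam₁ - 1 := by linarith
    positivity
  -- continuity of `K_{λ₂}^{∘(n+1)}` at `(t₀, s₀)` (row 613)
  have hc := continuousOn_kernel_comp_prod hlam₂' n (t₀, s₀) ⟨ht₀', hs₀'⟩
  rw [Metric.continuousWithinAt_iff] at hc
  obtain ⟨δ₂, hδ₂, hδ₂'⟩ := hc (ε / 2) (half_pos hε)
  refine ⟨min (min δ₂ a) (min (ε / (2 * M)) (min (lam₂ - lam₁) 1)),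
    lt_min (lt_min hδ₂ ha) (lt_min (by positivity) (lt_min (by linarith) one_pos)), ?_⟩
  rintro ⟨lam, t, s⟩ ⟨hlam, ht, hs⟩ hdist
  have hlam' : (1 : ℝ) < lam := hlam
  have ht' : (0 : ℝ) < t := ht
  have hs' : (0 : ℝ) < s := hs
  -- unpack the distance in the product metric
  rw [Prod.dist_eq, max_lt_iff] at hdist
  obtain ⟨hdl, hdx⟩ := hdist
  have hdl' : |lam - lam₂| < min (min δ₂ a) (min (ε / (2 * M)) (min (lam₂ - lam₁) 1)) := by
    rw [← Real.dist_eq]; exact hdl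
  have hl₁ : lam₁ ≤ lam := by
    have := (abs_lt.mp (lt_of_lt_of_le hdl' (le_trans (min_le_right _ _) (le_trans (min_le_right _ _) (min_le_left _ _))))).1
    linarith
  have hl₂ : lam ≤ lam₂ + 1 := by
    have := (abs_lt.mp (lt_of_lt_of_le hdl' (le_trans (min_le_right _ _) (le_trans (min_le_right _ _) (min_le_right _ _))))).2
    linarith
  have hdt : |t - t₀| < a := by
    have h := lt_of_lt_of_le hdx (le_trans (min_le_left _ _) (min_le_right _ _))
    rw [Prod.dist_eq, max_lt_iff] at h
    rw [← Real.dist_eq]; exact h.1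
  have hm : a ≤ max t s := by
    have h1 : a ≤ t₀ / 2 := by
      rw [ha_def]
      exact div_le_div_of_nonneg_right (min_le_left _ _) (by norm_num)
    have h2 := (abs_lt.mp hdt).1
    exact le_trans (by linarith) (le_max_left t s)
  have hdx₂ : dist (t, s) (t₀, s₀) < δ₂ := lt_of_lt_of_le hdx (le_trans (min_le_left _ _) (min_le_left _ _))
  -- the two pieces
  have hA : |((greenSolI (fun t => sph lam (hyp t)) (sphDecay lam))^[n] (fun r => sphGreenKernel lam r s)) t
      - ((greenSolI (fun t => sph lam₂ (hyp t)) (sphDecay lam₂))^[n] (fun r => sphGreenKernel lam₂ r s)) t| < ε / 2 := by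
    refine lt_of_le_of_lt (abs_kernel_comp_sub_le_of_mem hlam₁ hlam₁₂.le n hC hC' hl₁ hl₂ ht' hs' hm) ?_
    have hδ : |lam - lam₂| < ε / (2 * M) :=
      lt_of_lt_of_le hdl' (le_trans (min_le_right _ _) (min_le_left _ _))
    calc |lam - lam₂| * M < ε / (2 * M) * M := mul_lt_mul_of_pos_right hδ hM
      _ = ε / 2 := by field_simp
  have hB := hδ₂' (show (t, s) ∈ Ioi (0 : ℝ) ×ˢ Ioi (0 : ℝ) from ⟨ht', hs'⟩) hdx₂
  rw [Real.dist_eq] at hB ⊢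
  calc |((greenSolI (fun t => sph lam (hyp t)) (sphDecay lam))^[n] (fun r => sphGreenKernel lam r s)) t
        - ((greenSolI (fun t => sph lam₂ (hyp t)) (sphDecay lam₂))^[n] (fun r => sphGreenKernel lam₂ r s₀)) t₀|
      ≤ |((greenSolI (fun t => sph lam (hyp t)) (sphDecay lam))^[n] (fun r => sphGreenKernel lam r s)) t
          - ((greenSolI (fun t => sph lam₂ (hyp t)) (sphDecay lam₂))^[n] (fun r => sphGreenKernel lam₂ r s)) t|
        + |((greenSolI (fun t => sph lam₂ (hyp t)) (sphDecay lam₂))^[n] (fun r => sphGreenKernel lam₂ r s)) t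
          - ((greenSolI (fun t => sph lam₂ (hyp t)) (sphDecay lam₂))^[n] (fun r => sphGreenKernel lam₂ r s₀)) t₀| :=
        abs_sub_le _ _ _
    _ < ε / 2 + ε / 2 := add_lt_add hA hB
    _ = ε := by ring

/-- **The kernel is jointly continuous in `(λ, t, s)`** on `(1, ∞) × (0, ∞)²`. -/
theorem continuousOn_kernel_prod3 :
    ContinuousOn (fun p : ℝ × ℝ × ℝ => sphGreenKernel p.1 p.2.1 p.2.2) (Ioi 1 ×ˢ Ioi 0 ×ˢ Ioi 0) := by
  have h := continuousOn_kernel_comp_prod3 0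
  simpa only [Function.iterate_zero, id_eq] using h

end measure

end Summit.Ventures.HodgeRepro2.T5SU11KernelCompositionContinuousLam
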